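import Mathlib

/-!
# Route `FilamentSkeletonRss` · child crux `TangentSkeletonNearStraightL` (stmt-NavierStokesRegularity-23320) · registered line
# `child_tangent_analytic_strip_L` (b0b56c52900dd90a), stub `stub_stripPropagation` — brick: THE COMPLEXIFIED CHORD FOR A COMPLEX DISPLACEMENT

Companion of `Theorems.StadiumChord` (p817084/p817277, real displacement `s`).  The Cauchy-rectangle step of the contour shift (R7 of the STUB-PLAN memo
attached to 23320: local independence of the deformed source contour, vertical connectors) evaluates the squared chord
`Q(z, ζ) = Σᵢ (Fᵢ(ζ) − Fᵢ(z))²` for a COMPLEX displacement `s = ζ − z` whose segment lies in the stadium.  With unit speed continued bilinearly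
(`Σᵢ (F′)ᵢ² ≡ 1`) and `‖F′ − t̄‖ ≤ η` along the segment for some fixed `t̄ ∈ ℂ³`:
* `chord_sq_sub_sq_norm_le_complex` — `‖Q − s²‖ ≤ 6η²‖s‖²`;
* `chord_sq_re_ge_complex` — `Re Q ≥ Re(s²) − 6η²‖s‖² = (Re s)² − (Im s)² − 6η²‖s‖²`: positive on the vertical connectors `|Re s| = R > |Im s|`
  as soon as `R² − (Im s)² > 6η²(R² + (Im s)²)`.
HONEST FRAMING: a brick for a plan about a HYPOTHETICAL filament skeleton on the NEGATIVE side of a MODEL route; the stub `stub_stripPropagation` is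
NOT closed; nothing here bears on Navier–Stokes regularity or blow-up.  `--supports stmt-NavierStokesRegularity-23320`.
-/

set_option linter.dupNamespace false

noncomputable section

namespace Summit.NavierStokesRegularity.NavierStokesRegularity.Theorems.StadiumChordComplex

open Set Filter Topology
open scoped BigOperators

/-- **The complexified chord for a complex displacement.**  `F : ℂ → ℂ³` complex-differentiable on an open `U` with `Σᵢ (F′(w))ᵢ² = 1` on `U`;
if the segment `{z + r·s : r ∈ [0,1]}` lies in `U` and `‖F′(z + r·s) − t̄‖ ≤ η` along it for a fixed `t̄ : ℂ³`, then
`‖Σᵢ (Fᵢ(z+s) − Fᵢ(z))² − s²‖ ≤ 6η²‖s‖²`. [folklore] -/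
theorem chord_sq_sub_sq_norm_le_complex {U : Set ℂ} (hU : IsOpen U) {F : ℂ → (Fin 3 → ℂ)} (hF : DifferentiableOn ℂ F U)
    (hunit : ∀ w ∈ U, ∑ i, (deriv F w i) ^ 2 = 1) {z s : ℂ} {η : ℝ} (tbar : Fin 3 → ℂ)
    (hseg : ∀ r ∈ Set.Icc (0:ℝ) 1, z + (r : ℂ) * s ∈ U)
    (hη : ∀ r ∈ Set.Icc (0:ℝ) 1, ‖deriv F (z + (r : ℂ) * s) - tbar‖ ≤ η) :
    ‖(∑ i, (F (z + s) i - F z i) ^ 2) - s ^ 2‖ ≤ 6 * η ^ 2 * ‖s‖ ^ 2 := by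
  have hIcc : Set.uIcc (0:ℝ) 1 = Set.Icc 0 1 := uIcc_of_le zero_le_one
  set a : ℝ → (Fin 3 → ℂ) := fun r => deriv F (z + (r : ℂ) * s) with ha
  set d : ℝ → (Fin 3 → ℂ) := fun r => a r - tbar with hd
  -- continuity along the segment
  have hdcont : ContinuousOn (deriv F) U := ((hF.analyticOnNhd hU).deriv).continuousOn
  have hpath_cont : Continuous fun r : ℝ => z + (r : ℂ) * s :=
    continuous_const.add (Complex.continuous_ofReal.mul continuous_const)
  have ha_cont : ContinuousOn a (uIcc 0 1) := by
    rw [hIcc]; exact hdcont.comp hpath_cont.continuousOn fun r hr => hseg r hr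
  have hai_cont : ∀ i, ContinuousOn (fun r => a r i) (uIcc 0 1) := fun i =>
    (continuous_apply i).comp_continuousOn ha_cont
  have hdi_cont : ∀ i, ContinuousOn (fun r => d r i) (uIcc 0 1) := fun i =>
    (hai_cont i).sub continuousOn_const
  -- derivative of the path `r ↦ F(z + r s)` is `s • a r`
  have hderiv : ∀ r ∈ uIcc (0:ℝ) 1, HasDerivAt (fun r : ℝ => F (z + (r : ℂ) * s)) (s • a r) r := by
    intro r hr
    rw [hIcc] at hr
    have hFd : HasDerivAt F (deriv F (z + (r : ℂ) * s)) (z + (r : ℂ) * s) :=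
      (hF.differentiableAt (hU.mem_nhds (hseg r hr))).hasDerivAt
    have hp : HasDerivAt (fun r : ℝ => z + (r : ℂ) * s) s r := by
      have h1 := (((hasDerivAt_id r).ofReal_comp).mul_const s).const_add z
      simpa using h1
    exact hFd.scomp r hp
  have hFTC : ∀ i, F (z + s) i - F z i = s * ∫ r in (0:ℝ)..1, a r i := by
    intro i
    have hci : ∀ r ∈ uIcc (0:ℝ) 1, HasDerivAt (fun r : ℝ => F (z + (r : ℂ) * s) i) (s * a r i) r := by
      intro r hr
      have h := (hasDerivAt_pi.1 (hderiv r hr)) i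
      simpa [Pi.smul_apply, smul_eq_mul] using h
    have hint : IntervalIntegrable (fun r => s * a r i) MeasureTheory.volume 0 1 :=
      ((hai_cont i).intervalIntegrable).const_mul s
    have h := intervalIntegral.integral_eq_sub_of_hasDerivAt hci hint
    rw [intervalIntegral.integral_const_mul] at h
    rw [h]; simp
  -- `Wᵢ = t̄ᵢ + Dᵢ`
  set D : Fin 3 → ℂ := fun i => ∫ r in (0:ℝ)..1, d r i with hD
  have hW : ∀ i, ∫ r in (0:ℝ)..1, a r i = tbar i + D i := by
    intro i
    have h1 : (fun r => a r i) = fun r => tbar i + d r i := by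
      funext r; simp [hd]
    rw [h1, intervalIntegral.integral_add intervalIntegrable_const ((hdi_cont i).intervalIntegrable),
      intervalIntegral.integral_const]
    simp [hD]
  -- unit speed along the segment
  have hpt : ∀ r ∈ uIcc (0:ℝ) 1, ∑ i, tbar i * d r i = (1/2 : ℂ) - (1/2 : ℂ) * ∑ i, (tbar i) ^ 2 - (1/2 : ℂ) * ∑ i, (d r i) ^ 2 := by
    intro r hr
    rw [hIcc] at hr
    have h1 : ∑ i, (a r i) ^ 2 = 1 := hunit _ (hseg r hr)
    have h2 : ∀ i, a r i = tbar i + d r i := fun i => by simp [hd]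
    simp only [Fin.sum_univ_three] at h1 ⊢
    rw [h2 0, h2 1, h2 2] at h1
    linear_combination (1/2 : ℂ) * h1
  have hcross : ∑ i, tbar i * D i =
      ((1/2 : ℂ) - (1/2 : ℂ) * ∑ i, (tbar i) ^ 2) - (1/2 : ℂ) * ∫ r in (0:ℝ)..1, ∑ i, (d r i) ^ 2 := by
    have hSint : IntervalIntegrable (fun r => ∑ i, (d r i) ^ 2) MeasureTheory.volume 0 1 :=
      (ContinuousOn.intervalIntegrable (continuousOn_finsetSum _ fun i _ => (hdi_cont i).pow 2))
    have h1 : ∑ i, tbar i * D i = ∫ r in (0:ℝ)..1, ∑ i, tbar i * d r i := by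
      rw [intervalIntegral.integral_finsetSum fun i _ => ((hdi_cont i).intervalIntegrable.const_mul (tbar i))]
      refine Finset.sum_congr rfl fun i _ => ?_
      simp only [hD]
      exact (intervalIntegral.integral_const_mul (tbar i) _).symm
    have h2 : ∫ r in (0:ℝ)..1, ∑ i, tbar i * d r i =
        ∫ r in (0:ℝ)..1, (((1/2 : ℂ) - (1/2 : ℂ) * ∑ i, (tbar i) ^ 2) - (1/2 : ℂ) * ∑ i, (d r i) ^ 2) :=
      intervalIntegral.integral_congr fun r hr => hpt r hr
    rw [h1, h2, intervalIntegral.integral_sub intervalIntegrable_const (hSint.const_mul _),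
      intervalIntegral.integral_const, intervalIntegral.integral_const_mul]
    simp
  -- `Σ Wᵢ² − 1 = −∫ Σ dᵢ² + Σ Dᵢ²` and `Q − s² = s²·(Σ Wᵢ² − 1)`
  have hsum : (∑ i, (F (z + s) i - F z i) ^ 2) - s ^ 2 =
      s ^ 2 * (-(∫ r in (0:ℝ)..1, ∑ i, (d r i) ^ 2) + ∑ i, (D i) ^ 2) := by
    have hVi : ∀ i, F (z + s) i - F z i = s * (tbar i + D i) := fun i => by rw [hFTC i, hW i]
    simp only [Fin.sum_univ_three] at hcross ⊢
    rw [hVi 0, hVi 1, hVi 2]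
    linear_combination 2 * s ^ 2 * hcross
  -- bounds
  have hdn : ∀ r ∈ uIcc (0:ℝ) 1, ∀ i, ‖d r i‖ ≤ η := fun r hr i =>
    (norm_le_pi_norm (d r) i).trans (by rw [hIcc] at hr; simpa [hd, ha] using hη r hr)
  have hI : ‖∫ r in (0:ℝ)..1, ∑ i, (d r i) ^ 2‖ ≤ 3 * η ^ 2 := by
    have hb : ∀ r ∈ Set.uIoc (0:ℝ) 1, ‖∑ i, (d r i) ^ 2‖ ≤ 3 * η ^ 2 := by
      intro r hr
      have hr' : r ∈ uIcc (0:ℝ) 1 := uIoc_subset_uIcc hr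
      calc ‖∑ i, (d r i) ^ 2‖ ≤ ∑ i, ‖(d r i) ^ 2‖ := norm_sum_le _ _
        _ ≤ ∑ _i : Fin 3, η ^ 2 := Finset.sum_le_sum fun i _ => by
            rw [norm_pow]; exact pow_le_pow_left₀ (norm_nonneg _) (hdn r hr' i) 2
        _ = 3 * η ^ 2 := by simp
    have h := intervalIntegral.norm_integral_le_of_norm_le_const hb
    simpa using h
  have hDi : ∀ i, ‖D i‖ ≤ η := by
    intro i
    have hb : ∀ r ∈ Set.uIoc (0:ℝ) 1, ‖d r i‖ ≤ η := fun r hr => hdn r (uIoc_subset_uIcc hr) i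
    have h := intervalIntegral.norm_integral_le_of_norm_le_const hb
    simpa [hD] using h
  have h1 : ‖-(∫ r in (0:ℝ)..1, ∑ i, (d r i) ^ 2) + ∑ i, (D i) ^ 2‖ ≤ 6 * η ^ 2 := by
    have h2 : ‖∑ i, (D i) ^ 2‖ ≤ ∑ _i : Fin 3, η ^ 2 :=
      (norm_sum_le _ _).trans (Finset.sum_le_sum fun i _ => by
        rw [norm_pow]; exact pow_le_pow_left₀ (norm_nonneg _) (hDi i) 2)
    have h3 : ∑ _i : Fin 3, η ^ 2 = 3 * η ^ 2 := by simp
    calc ‖-(∫ r in (0:ℝ)..1, ∑ i, (d r i) ^ 2) + ∑ i, (D i) ^ 2‖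
        ≤ ‖-(∫ r in (0:ℝ)..1, ∑ i, (d r i) ^ 2)‖ + ‖∑ i, (D i) ^ 2‖ := norm_add_le _ _
      _ ≤ 3 * η ^ 2 + 3 * η ^ 2 := by rw [norm_neg]; exact add_le_add hI (h3 ▸ h2)
      _ = 6 * η ^ 2 := by ring
  rw [hsum, norm_mul, norm_pow]
  calc ‖s‖ ^ 2 * ‖-(∫ r in (0:ℝ)..1, ∑ i, (d r i) ^ 2) + ∑ i, (D i) ^ 2‖ ≤ ‖s‖ ^ 2 * (6 * η ^ 2) :=
        mul_le_mul_of_nonneg_left h1 (by positivity)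
    _ = 6 * η ^ 2 * ‖s‖ ^ 2 := by ring

/-- **Real part of the complexified chord for a complex displacement.**  Under the hypotheses of `chord_sq_sub_sq_norm_le_complex`:
`(Re s)² − (Im s)² − 6η²‖s‖² ≤ Re Σᵢ (Fᵢ(z+s) − Fᵢ(z))²`. [folklore] -/
theorem chord_sq_re_ge_complex {U : Set ℂ} (hU : IsOpen U) {F : ℂ → (Fin 3 → ℂ)} (hF : DifferentiableOn ℂ F U)
    (hunit : ∀ w ∈ U, ∑ i, (deriv F w i) ^ 2 = 1) {z s : ℂ} {η : ℝ} (tbar : Fin 3 → ℂ)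
    (hseg : ∀ r ∈ Set.Icc (0:ℝ) 1, z + (r : ℂ) * s ∈ U)
    (hη : ∀ r ∈ Set.Icc (0:ℝ) 1, ‖deriv F (z + (r : ℂ) * s) - tbar‖ ≤ η) :
    s.re ^ 2 - s.im ^ 2 - 6 * η ^ 2 * ‖s‖ ^ 2 ≤ (∑ i, (F (z + s) i - F z i) ^ 2).re := by
  have h := chord_sq_sub_sq_norm_le_complex hU hF hunit tbar hseg hη
  set Q : ℂ := ∑ i, (F (z + s) i - F z i) ^ 2 with hQ
  have hre : Q.re = (s.re ^ 2 - s.im ^ 2) + (Q - s ^ 2).re := by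
    simp [Complex.sub_re, sq, Complex.mul_re]
  have hlow : -(6 * η ^ 2 * ‖s‖ ^ 2) ≤ (Q - s ^ 2).re := by
    have h1 := Complex.abs_re_le_norm (Q - s ^ 2)
    have h2 := neg_abs_le (Q - s ^ 2).re
    linarith
  rw [hre]
  linarith

end Summit.NavierStokesRegularity.NavierStokesRegularity.Theorems.StadiumChordComplex

end
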